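import Mathlib
import Summits.Ventures.HodgeRepro.Tier4.Common.RowPlane
import Summits.Ventures.HodgeRepro.Tier4.Common.MixedPlaneKType
import Summits.Ventures.HodgeRepro.Tier4.Common.PlaneGenuine
import Summits.Ventures.HodgeRepro.Tier4.Line1.PlaneDefs
import Summits.Ventures.HodgeRepro.Tier4.Line4.TransportSelfAdjoint
import Summits.Ventures.HodgeRepro.Tier4.Line4.DistributionNonzero

/-!
# Tier4/Line4/SeesawGenuineRow — L1's `IsGenuineRow` for the mixed row plane with the CORRECTLY transported second
torus (`withTransportedTorus g' g` under the row similitude `g * B_U * gᵀ = lam • B_{U′}`), so that LINE L1's landed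
chain (`exists_regular_rational`, `exists_rational_conj`, `quotient_compact_genuine`, …) and this line's
`DistributionNonzero.exists_test_Jc_ne_zero` apply to LINE L4's own seesaw plane

Blind re-derivation cell `pub-hodge-repro`, Tier 4 «prove the step» (README §9–§10), seat t4-L4-p2 (gen 2; LINE L4).
Tree path `lean/Summits/Ventures/HodgeRepro/Tier4/Line4/SeesawGenuineRow.lean`.  Imports typer-2's `Common/RowPlane`
(`mixedRow`, `lineGramRow`, `ofLinesRow_P_mul_B`, `mixedRow_withTransportedTorus_isHermitianRow`,
`IsHermitianPlaneRow.omega_mul_B_of_t_eq_zero`), `Common/PlaneGenuine` (`omegaMat_sq`, `blockDiag4_smul`),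
`Common/MixedPlaneKType` (`withTransportedTorus`), L1's `Line1/PlaneDefs` (`IsGenuineRow`) and this line's
`Line4/TransportSelfAdjoint` (`withTransportedTorus_inv_Q_selfAdjoint`).

THE STATEMENT.  `IsGenuineRow ((mixedRow q a b).withTransportedTorus g' g …)` under: the NORMALISATION `q.t = 0`
(L1's `IsGenuineRow` wants `Ω² = −d • 1` scalar, i.e. `E′ = k(√−n)`; any `QuadData` can be normalised to it in
characteristic `0` by `ω ↦ ω − t/2`), `¬ IsSquare (−q.n)` (`E′` is a field — `DescribesCM`'s `c(ω) ≠ ω` gives it),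
`a, b ≠ 0` (the lines are non-degenerate), `g * g' = 1`, `g' * g = 1`, `g'` commuting with `Ω`, and the row similitude
`g * (mixedRow q a b).B * gᵀ = lam • (mixedRow q a' b').B` (no condition on `a', b'` is needed) — exactly the wall's seesaw configuration
with the transport taken in the direction `TransportSelfAdjoint` shows is the right one (`TransportProbe` shows the
other direction fails).  The six clauses: `Ω² = −n • 1` (`omegaMat_sq` at `t = 0`), `Ω B = −B Ωᵀ`
(`omega_mul_B_of_t_eq_zero`), `P i B = B (P i)ᵀ` (`ofLinesRow_P_mul_B`), `Q i B = B (Q i)ᵀ`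
(`withTransportedTorus_inv_Q_selfAdjoint` with `B′` the Gram matrix of `U′` and `ofLinesRow_P_mul_B` of `U′`),
`rank (P i) = 2` (`rank_diagonal` on `fromBlocks 1 0 0 0 = diagonal (Sum.elim 1 0)`, transported by `rank_reindex`),
`rank (Q i) = 2` (conjugation by the invertible `g` preserves rank).  COROLLARY `exists_test_Jc_ne_zero_seesaw`:
the weak W5 of `DistributionNonzero` on this plane — with `IsDefinite` (definite at SOME real place: the face's
signs at a place other than `w₀`, displayed), Fujisaki for the two tori (displayed) and continuous unitary characters,
some test function has `R.Jc f ≠ 0`.  Nothing here is about the wall's truth (the K-type constraint of W4 is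
not met by that test function).  HC_CM is NOT proved by anyone in this repository.
-/

set_option autoImplicit false

noncomputable section

namespace Summit.Ventures.HodgeRepro.Tier4.Line4

open Matrix Summit.Ventures.HodgeRepro.Tier4.Common Summit.Ventures.HodgeRepro.Tier4.Line1

section GenuineRow

variable {k : Type} [Field k] [CharZero k]

omit [CharZero k] in
/-- `Ω² = −n • 1` for the row plane when `t = 0`. -/
theorem ofLinesRow_Omega_sq (q : QuadData k) (ht : q.t = 0) (a b ε : k) :
    (PlaneData.ofLinesRow q a b ε).Ω * (PlaneData.ofLinesRow q a b ε).Ω =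
      -(q.n • (1 : Matrix (Fin 4) (Fin 4) k)) := by
  show blockDiag4 (omegaMat q) (omegaMat q) * blockDiag4 (omegaMat q) (omegaMat q) = _
  rw [blockDiag4_mul, omegaMat_sq, ht, zero_smul, zero_sub, ← blockDiag4_one, blockDiag4_smul]
  simp only [blockDiag4, ← map_neg, Matrix.fromBlocks_neg, neg_zero]

/-- The rank of the standard projectors of the row plane is `2`. -/
theorem ofLinesRow_P_rank (q : QuadData k) (a b ε : k) (i : Fin 2) :
    ((PlaneData.ofLinesRow q a b ε).P i).rank = 2 := by
  classical
  have hd0 : fromBlocks (1 : Matrix (Fin 2) (Fin 2) k) 0 0 0 =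
      diagonal (Sum.elim (fun _ : Fin 2 => (1 : k)) (fun _ : Fin 2 => (0 : k))) := by
    rw [← Matrix.fromBlocks_diagonal, Matrix.diagonal_one, Matrix.diagonal_zero]
  have hd1 : fromBlocks (0 : Matrix (Fin 2) (Fin 2) k) 0 0 1 =
      diagonal (Sum.elim (fun _ : Fin 2 => (0 : k)) (fun _ : Fin 2 => (1 : k))) := by
    rw [← Matrix.fromBlocks_diagonal, Matrix.diagonal_one, Matrix.diagonal_zero]
  have hc0 : Fintype.card {x : Fin 2 ⊕ Fin 2 // Sum.elim (fun _ : Fin 2 => (1 : k)) (fun _ : Fin 2 => (0 : k)) x ≠ 0}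
      = 2 := by
    rw [Fintype.card_subtype]
    have hset : (Finset.univ.filter fun x : Fin 2 ⊕ Fin 2 =>
        Sum.elim (fun _ : Fin 2 => (1 : k)) (fun _ : Fin 2 => (0 : k)) x ≠ 0) =
        Finset.univ.map ⟨Sum.inl, Sum.inl_injective⟩ := by
      ext x; rcases x with x | x <;> simp
    rw [hset, Finset.card_map, Finset.card_univ, Fintype.card_fin]
  have hc1 : Fintype.card {x : Fin 2 ⊕ Fin 2 // Sum.elim (fun _ : Fin 2 => (0 : k)) (fun _ : Fin 2 => (1 : k)) x ≠ 0}
      = 2 := by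
    rw [Fintype.card_subtype]
    have hset : (Finset.univ.filter fun x : Fin 2 ⊕ Fin 2 =>
        Sum.elim (fun _ : Fin 2 => (0 : k)) (fun _ : Fin 2 => (1 : k)) x ≠ 0) =
        Finset.univ.map ⟨Sum.inr, Sum.inr_injective⟩ := by
      ext x; rcases x with x | x <;> simp
    rw [hset, Finset.card_map, Finset.card_univ, Fintype.card_fin]
  have h0 : (blockDiag4 (1 : Matrix (Fin 2) (Fin 2) k) 0).rank = 2 := by
    unfold blockDiag4 re4
    rw [Matrix.coe_reindexAlgEquiv, Matrix.rank_reindex, hd0, Matrix.rank_diagonal, hc0]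
  have h1 : (blockDiag4 (0 : Matrix (Fin 2) (Fin 2) k) 1).rank = 2 := by
    unfold blockDiag4 re4
    rw [Matrix.coe_reindexAlgEquiv, Matrix.rank_reindex, hd1, Matrix.rank_diagonal, hc1]
  fin_cases i
  · exact h0
  · exact h1

/-- **L1's `IsGenuineRow` for the mixed row plane with the inverse-transported second torus.** -/
theorem isGenuineRow_mixedRow_transport (q : QuadData k) (ht : q.t = 0) (hn : ¬ IsSquare (-q.n))
    (a b a' b' : k) (ha : a ≠ 0) (hb : b ≠ 0)
    (g g' : Matrix (Fin 4) (Fin 4) k) (hgg' : g * g' = 1) (hg'g : g' * g = 1)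
    (hg'Ω : g' * (PlaneData.mixedRow q a b).Ω = (PlaneData.mixedRow q a b).Ω * g') (lam : k)
    (hiso : g * (PlaneData.mixedRow q a b).B * gᵀ = lam • (PlaneData.mixedRow q a' b').B) :
    IsGenuineRow ((PlaneData.mixedRow q a b).withTransportedTorus g' g hg'g hgg' hg'Ω) := by
  have hn0 : q.n ≠ 0 := by
    intro h0
    apply hn
    rw [h0, neg_zero]
    exact ⟨0, by ring⟩
  have hq : q.t ^ 2 - 4 * q.n ≠ 0 := by
    rw [ht]
    intro h
    apply hn0
    have : (4 : k) * q.n = 0 := by linear_combination -h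
    rcases mul_eq_zero.mp this with h4 | h4
    · exact absurd h4 (by norm_num)
    · exact h4
  have hherm := mixedRow_withTransportedTorus_isHermitianRow q a b ha hb hq g' g hg'g hgg' hg'Ω
  refine ⟨⟨q.n, ?_, hn⟩, ?_, ?_, ?_, ?_, ?_⟩
  · exact ofLinesRow_Omega_sq q ht a b (-1)
  · exact hherm.omega_mul_B_of_t_eq_zero q ht
  · intro i
    exact ofLinesRow_P_mul_B q a b (-1) i
  · intro i
    exact withTransportedTorus_inv_Q_selfAdjoint (PlaneData.mixedRow q a b) g g' hgg' hg'g hg'Ω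
      (PlaneData.mixedRow q a' b').B lam hiso i (ofLinesRow_P_mul_B q a' b' (-1) i)
  · intro i
    exact ofLinesRow_P_rank q a b (-1) i
  · intro i
    rw [withTransportedTorus_Q]
    have hg : IsUnit g.det := Matrix.isUnit_det_of_right_inverse hgg'
    have hg' : IsUnit g'.det := Matrix.isUnit_det_of_right_inverse hg'g
    rw [Matrix.rank_mul_eq_left_of_isUnit_det _ _ hg, Matrix.rank_mul_eq_right_of_isUnit_det _ _ hg']
    exact ofLinesRow_P_rank q a b (-1) i

end GenuineRow

section Corollary

open MeasureTheory NumberField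

variable {k : Type} [Field k] [NumberField k]

/-- **The weak W5 on LINE L4's seesaw plane (correct transport)**: some test function has a non-zero double period,
by name from `DistributionNonzero.exists_test_Jc_ne_zero` and `isGenuineRow_mixedRow_transport`. -/
theorem exists_test_Jc_ne_zero_seesaw (q : QuadData k) (ht : q.t = 0) (hn : ¬ IsSquare (-q.n))
    (a b a' b' : k) (ha : a ≠ 0) (hb : b ≠ 0) (g g' : Matrix (Fin 4) (Fin 4) k) (hgg' : g * g' = 1)
    (hg'g : g' * g = 1) (hg'Ω : g' * (PlaneData.mixedRow q a b).Ω = (PlaneData.mixedRow q a b).Ω * g') (lam : k)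
    (hiso : g * (PlaneData.mixedRow q a b).B * gᵀ = lam • (PlaneData.mixedRow q a' b').B)
    [MeasurableSpace (GA ((PlaneData.mixedRow q a b).withTransportedTorus g' g hg'g hgg' hg'Ω))]
    [BorelSpace (GA ((PlaneData.mixedRow q a b).withTransportedTorus g' g hg'g hgg' hg'Ω))]
    (R : RTFData ((PlaneData.mixedRow q a b).withTransportedTorus g' g hg'g hgg' hg'Ω))
    [R.μT.IsHaarMeasure] [R.μT'.IsHaarMeasure] (compT : IsCompact (closure R.DT)) (compT' : IsCompact (closure R.DT'))
    (hW : IsDefinite ((PlaneData.mixedRow q a b).withTransportedTorus g' g hg'g hgg' hg'Ω))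
    (hc : Continuous R.chi) (hu : ∀ x, ‖R.chi x‖ = 1) (hc' : Continuous R.chi') (hu' : ∀ x, ‖R.chi' x‖ = 1) :
    ∃ f, IsTestFn ((PlaneData.mixedRow q a b).withTransportedTorus g' g hg'g hgg' hg'Ω) f ∧ R.Jc f ≠ 0 :=
  exists_test_Jc_ne_zero _ R compT compT' hW
    (isGenuineRow_mixedRow_transport q ht hn a b a' b' ha hb g g' hgg' hg'g hg'Ω lam hiso) hc hu hc' hu'

end Corollary

end Summit.Ventures.HodgeRepro.Tier4.Line4

end
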